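import Mathlib
import HarnessLib.Audit
import Summits.PneNP.PneNP.Theorems.PstarGapTwoReaders
import Summits.PneNP.PneNP.Theorems.PstarGraphQuadGapTwo
import Summits.PneNP.PneNP.Theorems.PstarChordEndgameTools

/-!
# The two-query rung for reader families, by reduction to graph-quadratic systems (ROUND-24, item T24.19)

FRONTIER range-avoidance ladder, rung F-N3, ROUND 24 (cell `pnp-ideate`; restricted-model proof complexity — nothing here bears
on `P` versus `NP`).

`PstarGapTwoReaders.GapTwoReaders` (T24.19): on a pure typed `P⋆` instance with simple overlaps and variable degree `≤ Δ`, a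
minimal infeasible set `J` of READERS (outputs whose two XOR slots are `J`-private) under at most two parity constraints has
`|J| ≤ 64·Δ²`.  We prove it (`gapTwoReaders`, with the better constant `8·Δ²` on the way, `card_le_eight`) by the READER
SUBSTITUTION of the planner memo (ROUND-24-PRESEED §13 R10(p)(b), R10(t)) followed by the cell's theorem
`PstarGraphQuadGapTwo.graphQuadGapTwo` (T24.11c, two graph-quadratic constraints: `|E| ≤ 4Δ²·|W|`):

* every reader `g = (t_g, t'_g; p_g, q_g)` is solved for its second tip, `x_{t'_g} = x_{t_g} + y_g + a_{p_g} a_{q_g}`; under this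
  substitution a parity constraint `(C, b)` becomes the graph-quadratic constraint `qcon` with quadratic part the AND edges
  `{p_g, q_g}` of the readers with `t'_g ∈ C`, linear part `(C ∖ {t'}) △ {t_g : t'_g ∈ C}` and constant `b + Σ_{t'_g ∈ C} y_g`
  — the identity `bit_qval_qcon : qval = Σ_C z + Σ_{t'_g ∈ C} out_g(z)` holds at EVERY assignment;
* hence an assignment solving `J` satisfies `qcon (C,b)` iff it satisfies the parity, and an assignment solving `J ∖ {g₀}` but not
  `g₀` (which is what minimality provides, `W` being satisfied) satisfies `qcon (C,b)` iff `t'_{g₀} ∉ C`, i.e. iff the edge of `g₀`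
  is outside the quadratic part: this is `EdgeMinimal`; conversely every assignment is corrected on the (private, pairwise distinct)
  second tips to a solution of `J` with the same `qval`s, so infeasibility of `J ∪ W` is `Unsat`;
* the AND edges form a simple graph (injective slots; distinct readers have distinct AND pairs by simple overlaps) of maximum
  degree `≤ Δ` (`MaxDegree`), and `|J| = |E| ≤ 4Δ²·2`.

Boundary expansion and `|J| ≤ r` are not used.
-/

set_option linter.dupNamespace false

open Finset Literature.Computability.Complexity
open scoped symmDiff
open Summit.PneNP.PneNP.Theorems.PstarPDT (parity)
open Summit.PneNP.PneNP.Theorems.PstarTyped (Typed)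
open Summit.PneNP.PneNP.Theorems.PstarSALevel (varSet BoundaryExpanding SimpleOverlap)
open Summit.PneNP.PneNP.Theorems.PstarGapLemma (Sat Feasible MinInfeasible MaxDegree)
open Summit.PneNP.PneNP.Theorems.PstarGapPeeling (eval_pure)
open Summit.PneNP.PneNP.Theorems.PstarGapLinearised (andPair andPair_subset_varSet)
open Summit.PneNP.PneNP.Theorems.PstarCentreFree (vars_mem_varSet)
open Summit.PneNP.PneNP.Theorems.PstarFibrePolys (bit bit_xor bit_and bit_injective)
open Summit.PneNP.PneNP.Theorems.PstarProductRank (qform)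
open Summit.PneNP.PneNP.Theorems.PstarGraphQuadGap (Edge QCon qval QHolds Simple EdgeMaxDegree Supported Unsat EdgeMinimal quadCount)
open Summit.PneNP.PneNP.Theorems.PstarGraphQuadGapOne (bit_parity bit_qval)
open Summit.PneNP.PneNP.Theorems.PstarGraphQuadGapTwo (graphQuadGapTwo)
open Summit.PneNP.PneNP.Theorems.PstarGraphQuadGapTwoForms (sum_symmDiff_zmod2)
open Summit.PneNP.PneNP.Theorems.PstarGapTwoReaders (IsReader GapTwoReaders)
open Summit.PneNP.PneNP.Theorems.PstarChordEndgameTools (mem_andPair_iff eq_of_andPair_subset)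

namespace Summit.PneNP.PneNP.Theorems.PstarGapTwoReadersProof

variable {n m : ℕ}

/-- In `𝔽₂`, `x + x = 0`. -/
private theorem zmod2_add_self (x : ZMod 2) : x + x = 0 := by
  revert x; decide

/-! ## The substituted constraint -/

/-- The AND edge of output `g`, as an increasing pair. -/
def edge (I : LocalMap 4 n m) (g : Fin m) : Edge n := (min (I.vars g 2) (I.vars g 3), max (I.vars g 2) (I.vars g 3))

/-- The graph-quadratic constraint obtained from the parity constraint `w = (C, b)` by solving every reader `g ∈ J` for its second
tip `t'_g = I.vars g 1`: quadratic part = AND edges of the readers with `t'_g ∈ C`; linear part = `(C ∖ {t'_g : g ∈ J}) △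
{t_g : t'_g ∈ C}`; constant = `b ⊕ ⊕_{t'_g ∈ C} y_g`. -/
def qcon (I : LocalMap 4 n m) (J : Finset (Fin m)) (y : Fin m → Bool) (w : Finset (Fin n) × Bool) : QCon n :=
  ((J.filter fun g => I.vars g 1 ∈ w.1).image (edge I),
    (w.1 \ J.image fun g => I.vars g 1) ∆ ((J.filter fun g => I.vars g 1 ∈ w.1).image fun g => I.vars g 0),
    xor w.2 (parity (J.filter fun g => I.vars g 1 ∈ w.1) y))

/-- The quadratic part of the substituted constraint. -/
theorem qcon_fst (I : LocalMap 4 n m) (J : Finset (Fin m)) (y : Fin m → Bool) (w : Finset (Fin n) × Bool) :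
    (qcon I J y w).1 = (J.filter fun g => I.vars g 1 ∈ w.1).image (edge I) := rfl

/-- The linear part of the substituted constraint. -/
theorem qcon_snd_fst (I : LocalMap 4 n m) (J : Finset (Fin m)) (y : Fin m → Bool) (w : Finset (Fin n) × Bool) :
    (qcon I J y w).2.1 = (w.1 \ J.image fun g => I.vars g 1) ∆ ((J.filter fun g => I.vars g 1 ∈ w.1).image fun g => I.vars g 0) :=
  rfl

/-- The constant of the substituted constraint, in `𝔽₂`. -/
theorem bit_qcon_snd_snd (I : LocalMap 4 n m) (J : Finset (Fin m)) (y : Fin m → Bool) (w : Finset (Fin n) × Bool) :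
    bit (qcon I J y w).2.2 = bit w.2 + ∑ g ∈ J.filter (fun g => I.vars g 1 ∈ w.1), bit (y g) := by
  rw [show (qcon I J y w).2.2 = xor w.2 (parity (J.filter fun g => I.vars g 1 ∈ w.1) y) from rfl, bit_xor, bit_parity]

/-- The product over an increasing pair is the product over the pair. -/
theorem bit_edge_mul (I : LocalMap 4 n m) (g : Fin m) (z : Fin n → Bool) :
    bit (z (edge I g).1) * bit (z (edge I g).2) = bit (z (I.vars g 2)) * bit (z (I.vars g 3)) := by
  unfold edge
  rcases le_total (I.vars g 2) (I.vars g 3) with h | h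
  · rw [min_eq_left h, max_eq_right h]
  · rw [min_eq_right h, max_eq_left h, mul_comm]

/-- The endpoints of the edge of `g` form its AND pair. -/
theorem mem_andPair_of_edge (I : LocalMap 4 n m) (g : Fin m) (v : Fin n) (hv : v = (edge I g).1 ∨ v = (edge I g).2) :
    v ∈ andPair I g := by
  rw [mem_andPair_iff]
  unfold edge at hv
  rcases le_total (I.vars g 2) (I.vars g 3) with h | h
  · rw [min_eq_left h, max_eq_right h] at hv; exact hv
  · rw [min_eq_right h, max_eq_left h] at hv; exact hv.symm

/-- Conversely the AND pair lies on the edge. -/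
theorem edge_of_mem_andPair (I : LocalMap 4 n m) (g : Fin m) (v : Fin n) (hv : v ∈ andPair I g) :
    v = (edge I g).1 ∨ v = (edge I g).2 := by
  rw [mem_andPair_iff] at hv
  unfold edge
  rcases le_total (I.vars g 2) (I.vars g 3) with h | h
  · rw [min_eq_left h, max_eq_right h]; exact hv
  · rw [min_eq_right h, max_eq_left h]; exact hv.symm

/-- **Distinct outputs have distinct edges** (simple overlaps). -/
theorem edge_injective (I : LocalMap 4 n m) (hI : I.IsPure xorAndPred) (hS : SimpleOverlap I) {g h : Fin m}
    (he : edge I g = edge I h) : g = h :=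
  eq_of_andPair_subset I hI hS fun v hv => mem_andPair_of_edge I h v (he ▸ edge_of_mem_andPair I g v hv)

section Readers

variable (I : LocalMap 4 n m) (hI : I.IsPure xorAndPred) (hT : Typed I) (hS : SimpleOverlap I) {J : Finset (Fin m)}
  (hR : ∀ j ∈ J, IsReader I J j) (y : Fin m → Bool)

include hI hR in
/-- Tips of readers: `t_g ≠ t'_h` for all readers `g, h` of `J`. -/
theorem tip_ne_tip' {g h : Fin m} (hg : g ∈ J) (hh : h ∈ J) : I.vars g 0 ≠ I.vars h 1 := by
  intro heq
  by_cases hgh : h = g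
  · subst hgh; exact absurd (hI.2 h heq) (by decide)
  · exact hR h hh 1 (by decide) g hg (Ne.symm hgh) (heq ▸ vars_mem_varSet I g 0)

include hR in
/-- Second tips of distinct readers differ. -/
theorem tip'_injOn {g h : Fin m} (hg : g ∈ J) (hh : h ∈ J) (heq : I.vars g 1 = I.vars h 1) : g = h := by
  by_contra hgh
  exact hR h hh 1 (by decide) g hg hgh (heq ▸ vars_mem_varSet I g 1)

include hR in
/-- First tips of distinct readers differ. -/
theorem tip_injOn {g h : Fin m} (hg : g ∈ J) (hh : h ∈ J) (heq : I.vars g 0 = I.vars h 0) : g = h := by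
  by_contra hgh
  exact hR h hh 0 (by decide) g hg hgh (heq ▸ vars_mem_varSet I g 0)

include hI hS hR in
/-- **The substitution identity**: at EVERY assignment, the left-hand side of `qcon (C, b)` equals
`Σ_{v ∈ C} z_v + Σ_{g ∈ J, t'_g ∈ C} out_g(z)` in `𝔽₂`. -/
theorem bit_qval_qcon (w : Finset (Fin n) × Bool) (z : Fin n → Bool) :
    bit (qval (qcon I J y w) z) = ∑ v ∈ w.1, bit (z v) + ∑ g ∈ J.filter (fun g => I.vars g 1 ∈ w.1), bit (I.eval z g) := by
  classical
  set C := w.1 with hC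
  set J₁ := J.filter fun g => I.vars g 1 ∈ C with hJ₁
  have hJ₁J : ∀ g ∈ J₁, g ∈ J := fun g hg => (mem_filter.1 hg).1
  rw [bit_qval, qcon_fst, qcon_snd_fst]
  simp only [← hC, ← hJ₁]
  -- quadratic part
  have hq : qform (J₁.image (edge I)) Prod.fst Prod.snd (fun v => bit (z v)) =
      ∑ g ∈ J₁, bit (z (I.vars g 2)) * bit (z (I.vars g 3)) := by
    unfold qform
    rw [sum_image fun g hg h hh he => edge_injective I hI hS he]
    exact sum_congr rfl fun g _ => bit_edge_mul I g z
  -- linear part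
  have hX : C ∩ J.image (fun g => I.vars g 1) = J₁.image fun g => I.vars g 1 := by
    ext v
    simp only [mem_inter, mem_image, hJ₁, mem_filter]
    constructor
    · rintro ⟨hv, g, hg, rfl⟩; exact ⟨g, ⟨hg, hv⟩, rfl⟩
    · rintro ⟨g, ⟨hg, hv⟩, rfl⟩; exact ⟨hv, g, hg, rfl⟩
  have h3 : ∑ v ∈ J₁.image (fun g => I.vars g 1), bit (z v) = ∑ g ∈ J₁, bit (z (I.vars g 1)) :=
    sum_image fun g hg h hh he => tip'_injOn I hR (hJ₁J g hg) (hJ₁J h hh) he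
  have h1 : ∑ v ∈ C \ J.image (fun g => I.vars g 1), bit (z v) + ∑ g ∈ J₁, bit (z (I.vars g 1)) = ∑ v ∈ C, bit (z v) := by
    rw [← h3, ← hX, ← sdiff_inter_self_left, sum_sdiff inter_subset_left]
  have h2 : ∑ v ∈ J₁.image (fun g => I.vars g 0), bit (z v) = ∑ g ∈ J₁, bit (z (I.vars g 0)) :=
    sum_image fun g hg h hh he => tip_injOn I hR (hJ₁J g hg) (hJ₁J h hh) he
  have hl : ∑ v ∈ (C \ J.image fun g => I.vars g 1) ∆ (J₁.image fun g => I.vars g 0), bit (z v) =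
      ∑ v ∈ C, bit (z v) + ∑ g ∈ J₁, bit (z (I.vars g 1)) + ∑ g ∈ J₁, bit (z (I.vars g 0)) := by
    rw [sum_symmDiff_zmod2, h2, ← h1]
    have := zmod2_add_self (∑ g ∈ J₁, bit (z (I.vars g 1)))
    linear_combination -this
  -- outputs
  have he : ∑ g ∈ J₁, bit (I.eval z g) =
      ∑ g ∈ J₁, bit (z (I.vars g 0)) + ∑ g ∈ J₁, bit (z (I.vars g 1)) + ∑ g ∈ J₁, bit (z (I.vars g 2)) * bit (z (I.vars g 3)) := by
    rw [← sum_add_distrib, ← sum_add_distrib]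
    refine sum_congr rfl fun g _ => ?_
    rw [eval_pure I hI, bit_xor, bit_xor, bit_and]
  rw [hq, hl, he]
  ring

include hI hS hR in
/-- **On a solution of `J`** the substituted constraint is the original parity constraint. -/
theorem qholds_of_solves (w : Finset (Fin n) × Bool) {z : Fin n → Bool} (hz : ∀ g ∈ J, I.eval z g = y g) :
    QHolds (qcon I J y w) z ↔ parity w.1 z = w.2 := by
  classical
  unfold QHolds
  rw [← bit_injective.eq_iff, ← bit_injective.eq_iff (a := parity w.1 z), bit_qval_qcon I hI hS hR y w z, bit_parity]
  have hc := bit_qcon_snd_snd I J y w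
  have hsum : ∑ g ∈ J.filter (fun g => I.vars g 1 ∈ w.1), bit (I.eval z g) = ∑ g ∈ J.filter (fun g => I.vars g 1 ∈ w.1), bit (y g) :=
    sum_congr rfl fun g hg => by rw [hz g (mem_filter.1 hg).1]
  rw [hc, hsum]
  constructor
  · intro h; exact add_right_cancel h
  · intro h; rw [h]

include hI hS hR in
/-- **On an almost-solution** (every reader of `J` satisfied except `g₀`, which is violated) that satisfies the parity, the
substituted constraint holds iff the second tip of `g₀` is outside `C`. -/
theorem qholds_of_almost (w : Finset (Fin n) × Bool) {z : Fin n → Bool} {g₀ : Fin m} (hg₀ : g₀ ∈ J)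
    (hz : ∀ g ∈ J, g ≠ g₀ → I.eval z g = y g) (hv : I.eval z g₀ ≠ y g₀) (hpar : parity w.1 z = w.2) :
    QHolds (qcon I J y w) z ↔ I.vars g₀ 1 ∉ w.1 := by
  classical
  set J₁ := J.filter fun g => I.vars g 1 ∈ w.1 with hJ₁
  have hbit : bit (I.eval z g₀) = bit (y g₀) + 1 := by
    revert hv
    cases I.eval z g₀ <;> cases y g₀ <;> decide
  have hq : QHolds (qcon I J y w) z ↔ ∑ g ∈ J₁, bit (I.eval z g) = ∑ g ∈ J₁, bit (y g) := by
    unfold QHolds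
    rw [← bit_injective.eq_iff, bit_qval_qcon I hI hS hR y w z, ← hJ₁]
    have hc : bit (qcon I J y w).2.2 = bit w.2 + ∑ g ∈ J₁, bit (y g) := bit_qcon_snd_snd I J y w
    rw [hc, ← bit_parity, hpar]
    constructor
    · intro h; exact add_left_cancel h
    · intro h; rw [h]
  rw [hq]
  by_cases hmem : I.vars g₀ 1 ∈ w.1
  · have hg₀J₁ : g₀ ∈ J₁ := mem_filter.2 ⟨hg₀, hmem⟩
    simp only [hmem, not_true_eq_false, iff_false]
    intro h
    rw [← add_sum_erase _ _ hg₀J₁, ← add_sum_erase _ (fun g => bit (y g)) hg₀J₁, hbit,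
      sum_congr rfl fun g hg => by rw [hz g (mem_filter.1 (mem_of_mem_erase hg)).1 (ne_of_mem_erase hg)]] at h
    have h1 : (1 : ZMod 2) = 0 := by linear_combination h
    exact absurd h1 (by decide)
  · simp only [hmem, not_false_eq_true, iff_true]
    refine sum_congr rfl fun g hg => ?_
    have hne : g ≠ g₀ := fun h => hmem (h ▸ (mem_filter.1 hg).2)
    rw [hz g (mem_filter.1 hg).1 hne]

/-- `qval` reads only the edge endpoints and the linear part. -/
theorem qval_congr {V : ℕ} (w : QCon V) {a a' : Fin V → Bool} (he : ∀ e ∈ w.1, a e.1 = a' e.1 ∧ a e.2 = a' e.2)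
    (hl : ∀ v ∈ w.2.1, a v = a' v) : qval w a = qval w a' := by
  unfold PstarGraphQuadGap.qval PstarPDT.parity
  have h1 : (w.1.filter fun e => a e.1 = true ∧ a e.2 = true) = w.1.filter fun e => a' e.1 = true ∧ a' e.2 = true :=
    filter_congr fun e he' => by rw [(he e he').1, (he e he').2]
  have h2 : (w.2.1.filter fun v => a v = true) = w.2.1.filter fun v => a' v = true :=
    filter_congr fun v hv' => by rw [hl v hv']
  rw [h1, h2]

include hI hT hR in
/-- **Correcting on the second tips.**  Every assignment agrees, off the second tips of the readers, with a solution of `J`; the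
substituted constraints do not read second tips, so their values are unchanged. -/
theorem exists_solution_same_qval (a : Fin n → Bool) :
    ∃ z : Fin n → Bool, (∀ g ∈ J, I.eval z g = y g) ∧ ∀ w : Finset (Fin n) × Bool, qval (qcon I J y w) z = qval (qcon I J y w) a := by
  classical
  -- the corrected assignment
  set val : Fin m → Bool := fun g => xor (xor (a (I.vars g 0)) (y g)) (a (I.vars g 2) && a (I.vars g 3)) with hval
  set z : Fin n → Bool := fun v => if h : ∃ g, g ∈ J ∧ I.vars g 1 = v then val (Classical.choose h) else a v with hz
  have hz_tip' : ∀ g ∈ J, z (I.vars g 1) = val g := by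
    intro g hg
    have hex : ∃ g', g' ∈ J ∧ I.vars g' 1 = I.vars g 1 := ⟨g, hg, rfl⟩
    simp only [hz, hex, dif_pos]
    have hspec := Classical.choose_spec hex
    rw [tip'_injOn I hR hspec.1 hg hspec.2]
  have hz_other : ∀ v, (∀ g ∈ J, I.vars g 1 ≠ v) → z v = a v := by
    intro v hv
    have hno : ¬ ∃ g, g ∈ J ∧ I.vars g 1 = v := fun ⟨g, hg, hgv⟩ => hv g hg hgv
    simp only [hz, hno, dif_neg, not_false_eq_true]
  have hz_and : ∀ (j : Fin m) (s : Fin 4), 2 ≤ s.val → z (I.vars j s) = a (I.vars j s) := fun j s hs =>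
    hz_other _ fun g _ h => hT g j 1 s (by decide) hs h
  have hz_tip : ∀ g ∈ J, z (I.vars g 0) = a (I.vars g 0) := fun g hg =>
    hz_other _ fun h hh heq => tip_ne_tip' I hI hR hg hh heq.symm
  refine ⟨z, fun g hg => ?_, fun w => qval_congr _ (fun e he => ?_) (fun v hv => ?_)⟩
  · have hvg : val g = xor (xor (a (I.vars g 0)) (y g)) (a (I.vars g 2) && a (I.vars g 3)) := rfl
    rw [eval_pure I hI, hz_tip g hg, hz_tip' g hg, hz_and g 2 (by decide), hz_and g 3 (by decide), hvg]
    cases a (I.vars g 0) <;> cases y g <;> cases (a (I.vars g 2) && a (I.vars g 3)) <;> rfl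
  · -- edges: AND-slot variables
    rw [qcon_fst] at he
    obtain ⟨g, -, rfl⟩ := mem_image.1 he
    unfold edge
    rcases le_total (I.vars g 2) (I.vars g 3) with h | h
    · rw [min_eq_left h, max_eq_right h]; exact ⟨hz_and g 2 (by decide), hz_and g 3 (by decide)⟩
    · rw [min_eq_right h, max_eq_left h]; exact ⟨hz_and g 3 (by decide), hz_and g 2 (by decide)⟩
  · -- linear part: no second tip
    rw [qcon_snd_fst] at hv
    rcases (mem_symmDiff.1 hv) with ⟨h1, -⟩ | ⟨h1, -⟩
    · refine hz_other v fun g hg hgv => (mem_sdiff.1 h1).2 (mem_image.2 ⟨g, hg, hgv⟩)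
    · obtain ⟨g, hg, rfl⟩ := mem_image.1 h1
      exact hz_tip g (mem_filter.1 hg).1

end Readers

/-! ## The graph of AND edges -/

/-- The edges of the outputs of `J` form a simple graph. -/
theorem simple_edges (I : LocalMap 4 n m) (hI : I.IsPure xorAndPred) (J : Finset (Fin m)) : Simple (J.image (edge I)) := by
  intro e he
  obtain ⟨g, -, rfl⟩ := mem_image.1 he
  unfold edge
  exact min_lt_max.2 fun h => absurd (hI.2 g h) (by decide)

/-- Under `MaxDegree Δ` the edge graph has maximum degree `≤ Δ`. -/
theorem edgeMaxDegree_edges (I : LocalMap 4 n m) {Δ : ℕ} (hD : MaxDegree Δ I) (J : Finset (Fin m)) :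
    EdgeMaxDegree Δ (J.image (edge I)) := by
  classical
  intro v
  have hsub : (J.image (edge I)).filter (fun e => e.1 = v ∨ e.2 = v) ⊆ (univ.filter fun j : Fin m => v ∈ varSet I j).image (edge I) := by
    intro e he
    obtain ⟨he, hv⟩ := mem_filter.1 he
    obtain ⟨g, -, rfl⟩ := mem_image.1 he
    refine mem_image.2 ⟨g, mem_filter.2 ⟨mem_univ _, andPair_subset_varSet I g (mem_andPair_of_edge I g v ?_)⟩, rfl⟩
    rcases hv with h | h
    · exact Or.inl h.symm
    · exact Or.inr h.symm
  exact (card_le_card hsub).trans (card_image_le.trans (hD v))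

/-! ## The rung -/

/-- **T24.19 with the constant `8`**: a minimal infeasible reader family under at most two parity constraints has at most `8·Δ²`
outputs. -/
theorem card_le_eight {Δ : ℕ} (I : LocalMap 4 n m) (hI : I.IsPure xorAndPred) (hT : Typed I) (hS : SimpleOverlap I)
    (hD : MaxDegree Δ I) (y : Fin m → Bool) (W : Finset (Finset (Fin n) × Bool)) (J : Finset (Fin m)) (hW : W.card ≤ 2)
    (hR : ∀ j ∈ J, IsReader I J j) (hmin : MinInfeasible I y W J) : J.card ≤ 8 * Δ ^ 2 := by
  classical
  set E := J.image (edge I) with hE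
  set W' := W.image (qcon I J y) with hW'
  have hJE : J.card = E.card := (card_image_of_injOn fun g _ h _ he => edge_injective I hI hS he).symm
  -- supported
  have hsupp : Supported E W' := by
    intro w' hw'
    obtain ⟨w, -, rfl⟩ := mem_image.1 hw'
    rw [qcon_fst]
    exact image_subset_image (filter_subset _ _)
  -- unsat
  have hU : Unsat W' := by
    rintro ⟨a, ha⟩
    obtain ⟨z, hzJ, hzq⟩ := exists_solution_same_qval I hI hT hR y a
    refine hmin.1 ⟨z, fun w hw => ?_, hzJ⟩
    have hq : QHolds (qcon I J y w) z := by
      have := ha _ (mem_image_of_mem _ hw)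
      unfold PstarGraphQuadGap.QHolds at this ⊢
      rw [hzq w]; exact this
    exact (qholds_of_solves I hI hS hR y w hzJ).1 hq
  -- edge-minimal
  have hM : EdgeMinimal E W' := by
    intro j hj
    obtain ⟨g₀, hg₀, rfl⟩ := mem_image.1 hj
    obtain ⟨z, hzW, hzJ⟩ := hmin.2 g₀ hg₀
    have hviol : I.eval z g₀ ≠ y g₀ := by
      intro h
      exact hmin.1 ⟨z, hzW, fun g hg => if hgg : g = g₀ then hgg ▸ h else hzJ g (mem_erase.2 ⟨hgg, hg⟩)⟩
    refine ⟨z, fun w' hw' => ?_⟩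
    obtain ⟨w, hw, rfl⟩ := mem_image.1 hw'
    rw [qholds_of_almost I hI hS hR y w hg₀ (fun g hg hne => hzJ g (mem_erase.2 ⟨hne, hg⟩)) hviol (hzW w hw), qcon_fst]
    simp only [mem_image, mem_filter, not_exists, not_and]
    constructor
    · intro h g hg he
      exact h (edge_injective I hI hS he ▸ hg.2)
    · intro h hmem
      exact h g₀ ⟨hg₀, hmem⟩ rfl
  -- at most two quadratic constraints
  have hq2 : quadCount W' ≤ 2 := by
    unfold PstarGraphQuadGap.quadCount
    exact (card_filter_le _ _).trans (card_image_le.trans hW)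
  have hmain := graphQuadGapTwo Δ n E W' (simple_edges I hI J) (edgeMaxDegree_edges I hD J) hsupp hU hM hq2
  have hW'2 : W'.card ≤ 2 := card_image_le.trans hW
  calc J.card = E.card := hJE
    _ ≤ 4 * Δ ^ 2 * W'.card := hmain
    _ ≤ 4 * Δ ^ 2 * 2 := Nat.mul_le_mul_left _ hW'2
    _ = 8 * Δ ^ 2 := by ring

/-- **T24.19 — `GapTwoReaders` holds**: on a pure typed `P⋆` instance with simple overlaps and variable degree `≤ Δ`, a minimal
infeasible reader family under at most two parity constraints has at most `64·Δ²` (indeed `8·Δ²`) outputs.  Reader substitution +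
`PstarGraphQuadGapTwo.graphQuadGapTwo`.  FRONTIER; nothing here bears on `P` versus `NP`. -/
theorem gapTwoReaders : GapTwoReaders := by
  intro Δ n m r I hI hT _ hS hD y W J hW _ hR hmin
  exact (card_le_eight I hI hT hS hD y W J hW hR hmin).trans (Nat.mul_le_mul_right _ (by norm_num))

end Summit.PneNP.PneNP.Theorems.PstarGapTwoReadersProof
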